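import Summits.Ventures.Crystal3D.Theorems.StickyWulffConstantTextureLiminfBilayerWallBookkeeping
import Summits.Ventures.Crystal3D.Theorems.StickyWulffConstantTextureLiminfCellFlux
import Summits.Ventures.Crystal3D.Theorems.StickyWulffConstantGenericWallFloorCredits
import HarnessLib

/-!
# The wall-cell inequality from a census in AREA currency (lane T, (β) assembly glue; crux `TextureLiminfV5`, stmt-Ventures-23912)

HONEST FRAMING. Venture `Summits/Ventures/Crystal3D` (cell `crystal3d-full`), route `route-Ventures-StickyWulffConstant`, helper `--supports` the
law-v5 crux `TextureLiminfV5` (stmt-Ventures-23912), lane T, registered stub `stub_terraceCensus` (RESUME (d) assembly; cf-p1 (cccxvii): «the final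
constant C of BilayerWallResidualFaultedCoreOnAt … C 10 absorbs C·ρ terms»).  Bookkeeping only, standard axioms; census-free, certificate-free;
nothing about any wall law beyond the stated implication; F-C1 not moved.

THE GLUE.  A census in area currency delivers, cell by cell (radius `ρ ≥ ρ₀`, height `h`), a supply bound
`M·π·(ρ − 4)² ≤ sF·Σ_PAY (12 − deg) + C_rest·(1 + h)·ρ` (`PAY = {y ∈ X : deg y ≠ 12, −R₀−2 ≤ y₂ ≤ h+R₀+2}`, lane T's payer set; for the
(β) plates side `M = √2·(V₁ + V₂) ≥ √6·(S₁ + S₂)`, …LevelReachPlatesFluxAreaCell).  The CHARGE of a table `0 ≤ c ≤ c₀` on the unit slice is at most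
`c₀·π·ρ²` (`two_charge_le_const`, …CellFlux).  Hence, as soon as the SUPPLY INEQUALITY `2·c₀·sF ≤ M` holds, the payer bound of
`bilayerWallAt_of_payerBound` (…BilayerWallBookkeeping) follows with an explicit rim constant, and with it `BilayerWallAt`:
* `payerSum_nonneg` — every payer term `12 − deg` is nonnegative (kissing number, `card_filter_dist_eq_one_le_twelve`);
* `two_charge_slice_le_cap_area` — `2·Q(slice ρ) ≤ 2·c₀·π·ρ²` for `0 ≤ c ≤ c₀`;
* **`payerBound_of_areaCensus`** — the real-arithmetic step: `2c₀πρ² ≤ (M/sF)·π·(ρ−4)² + (8Mπ/sF)·ρ`, small cells `ρ < ρ₀` paid by `2c₀πρ₀·ρ`;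
* **`bilayerWallAt_of_areaCensus`** — census in area currency + supply inequality ⇒
  `BilayerWallAt ((C_rest/sF + 8·M·π/sF + 2·c₀·π·ρ₀ + 3456 + 1152·(R₀+1))/2) R₀ σ₁ σ₂ L₁ L₂ s₁ s₂ c`.
WHAT THIS IS NOT: any census, any supply inequality, any bound on located cuts or born lines; F-C1 not moved.
-/

noncomputable section

namespace Summit.Ventures.Crystal3D.Theorems

open MeasureTheory Set Finset
open scoped ENNReal InnerProductSpace
open Literature.MathematicalPhysics.StatisticalMechanics (IsHaggSeq)
open Summit.Ventures.Crystal3D.Cruxes.TextureLiminf.TexShadow (E3 cyl stacking laySlab BilayerWallAt)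

/-- Lane T's payer sum is nonnegative (kissing number twelve). -/
theorem payerSum_nonneg (X : Finset E3) (hX : ∀ p ∈ X, ∀ q ∈ X, p ≠ q → 1 ≤ dist p q) (R₀ h : ℝ) :
    0 ≤ ∑ y ∈ X.filter (fun y => (X.filter fun q => dist y q = 1).card ≠ 12 ∧ -R₀ - 2 ≤ y 2 ∧ y 2 ≤ h + R₀ + 2),
      ((12 : ℝ) - ((X.filter fun q => dist y q = 1).card : ℝ)) := by
  classical
  refine sum_nonneg fun y _ => ?_
  have h12 : ((X.filter fun q => dist y q = 1).card : ℝ) ≤ 12 := by exact_mod_cast card_filter_dist_eq_one_le_twelve X hX y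
  linarith

/-- **The charge of a capped table on the unit slice is at most `c₀ · π ρ²`.** -/
theorem two_charge_slice_le_cap_area (L₁ L₂ : E3 ≃ₗᵢ[ℝ] E3) (s₁ s₂ : E3) (c : ℤ → ℤ → ℝ) {c₀ : ℝ}
    (hc0 : ∀ i j, 0 ≤ c i j) (hcB : ∀ i j, c i j ≤ c₀) (ρ : ℝ) (hρ : 0 ≤ ρ) :
    2 * ∑' ij : ℤ × ℤ, c ij.1 ij.2 *
        (volume ({q : E3 | 0 ≤ q 2 ∧ q 2 ≤ 1 ∧ q 0 ^ 2 + q 1 ^ 2 ≤ ρ ^ 2} ∩ laySlab L₁ s₁ ij.1 ∩ laySlab L₂ s₂ ij.2)).toReal ≤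
      2 * c₀ * (Real.pi * ρ ^ 2) := by
  have hset : ({q : E3 | 0 ≤ q 2 ∧ q 2 ≤ 1 ∧ q 0 ^ 2 + q 1 ^ 2 ≤ ρ ^ 2} : Set E3) = wallSlice ρ := rfl
  have h := two_charge_le_const L₁ L₂ s₁ s₂ c c₀ hc0 hcB (wallSlice ρ) (measurableSet_wallSlice ρ)
    (by rw [volume_wallSlice ρ hρ]; exact ENNReal.ofReal_ne_top)
  rw [volume_wallSlice ρ hρ, ENNReal.toReal_ofReal (by positivity)] at h
  rw [hset]; exact h

/-- **The arithmetic of the area ledger.**  If `2·c₀·sF ≤ M` (`sF > 0`, `c₀ ≥ 0`) then for every `ρ ≥ 0`, `h ≥ 0`: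
from `M·π·(ρ−4)² ≤ sF·PAY + C_rest·(1+h)·ρ` follows `2·c₀·π·ρ² ≤ PAY + (C_rest/sF + 8·M·π/sF)·(1+h)·ρ`. -/
theorem payerBound_of_areaCensus {c₀ sF M Crest PAY ρ h : ℝ} (hc₀ : 0 ≤ c₀) (hsF : 0 < sF) (hM : 2 * c₀ * sF ≤ M)
    (hρ : 0 ≤ ρ) (hh : 0 ≤ h) (hcensus : M * Real.pi * (ρ - 4) ^ 2 ≤ sF * PAY + Crest * (1 + h) * ρ) :
    2 * c₀ * (Real.pi * ρ ^ 2) ≤ PAY + (Crest / sF + 8 * M * Real.pi / sF) * (1 + h) * ρ := by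
  have hπ := Real.pi_pos.le
  have hM0 : 0 ≤ M := le_trans (by positivity) hM
  -- divide the census by `sF`
  have h1 : M / sF * Real.pi * (ρ - 4) ^ 2 ≤ PAY + Crest / sF * (1 + h) * ρ := by
    have e1 : M / sF * Real.pi * (ρ - 4) ^ 2 = (M * Real.pi * (ρ - 4) ^ 2) / sF := by ring
    have e2 : PAY + Crest / sF * (1 + h) * ρ = (sF * PAY + Crest * (1 + h) * ρ) / sF := by field_simp
    rw [e1, e2]; exact div_le_div_of_nonneg_right hcensus hsF.le
  -- `2 c₀ ≤ M / sF`
  have h2 : 2 * c₀ ≤ M / sF := by rw [le_div_iff₀ hsF]; linarith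
  have h3 : 2 * c₀ * (Real.pi * ρ ^ 2) ≤ M / sF * Real.pi * ρ ^ 2 := by nlinarith [mul_nonneg hπ (sq_nonneg ρ)]
  -- `(ρ − 4)² ≥ ρ² − 8ρ`
  have h4 : M / sF * Real.pi * ρ ^ 2 ≤ M / sF * Real.pi * (ρ - 4) ^ 2 + 8 * M * Real.pi / sF * ρ := by
    have hMs : 0 ≤ M / sF * Real.pi := by positivity
    have e : M / sF * Real.pi * (ρ - 4) ^ 2 + 8 * M * Real.pi / sF * ρ = M / sF * Real.pi * ρ ^ 2 + 16 * (M / sF * Real.pi) := by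
      ring
    rw [e]; linarith
  have h5 : 8 * M * Real.pi / sF * ρ ≤ 8 * M * Real.pi / sF * (1 + h) * ρ := by
    have : 0 ≤ 8 * M * Real.pi / sF * ρ := by positivity
    nlinarith
  nlinarith [h1, h3, h4, h5]

/-- **THE WALL CELL FROM A CENSUS IN AREA CURRENCY.**  See the module docstring: the census (for cells of radius `ρ ≥ ρ₀`, any `ρ₀ ≥ R₀`), the
supply inequality `2·c₀·sF ≤ M` and a table `0 ≤ c ≤ c₀` give `BilayerWallAt` with an explicit rim constant. -/
theorem bilayerWallAt_of_areaCensus {σ₁ σ₂ : ℤ → ℤ} (hσ₁ : IsHaggSeq σ₁) (hσ₂ : IsHaggSeq σ₂)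
    (L₁ L₂ : E3 ≃ₗᵢ[ℝ] E3) (s₁ s₂ : E3) (R₀ : ℝ) (hR₀ : 3 ≤ R₀) (c : ℤ → ℤ → ℝ) {c₀ : ℝ}
    (hc0 : ∀ i j, 0 ≤ c i j) (hcB : ∀ i j, c i j ≤ c₀)
    {sF M Crest ρ₀ : ℝ} (hsF : 0 < sF) (hM : 2 * c₀ * sF ≤ M) (hCrest : 0 ≤ Crest) (hρ₀ : R₀ ≤ ρ₀)
    (hcensus : ∀ h : ℝ, 0 ≤ h → ∀ ρ : ℝ, ρ₀ ≤ ρ → ∀ X P₁ P₂ : Finset E3,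
      (∀ p ∈ X, ∀ q ∈ X, p ≠ q → 1 ≤ dist p q) → P₁ ⊆ X → P₂ ⊆ X \ P₁ → (∀ p ∈ X, p ∈ cyl R₀ h ρ) →
      (∀ p, p ∈ P₁ ↔ (p ∈ stacking L₁ s₁ σ₁ ∧ -(2 * R₀) ≤ p 2 ∧ p 2 ≤ -R₀ ∧ p 0 ^ 2 + p 1 ^ 2 ≤ ρ ^ 2)) →
      (∀ p, p ∈ P₂ ↔ (p ∈ stacking L₂ s₂ σ₂ ∧ h + R₀ ≤ p 2 ∧ p 2 ≤ h + 2 * R₀ ∧ p 0 ^ 2 + p 1 ^ 2 ≤ ρ ^ 2)) →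
      M * Real.pi * (ρ - 4) ^ 2 ≤
        sF * (∑ y ∈ X.filter (fun y => (X.filter fun q => dist y q = 1).card ≠ 12 ∧ -R₀ - 2 ≤ y 2 ∧ y 2 ≤ h + R₀ + 2),
          ((12 : ℝ) - ((X.filter fun q => dist y q = 1).card : ℝ))) + Crest * (1 + h) * ρ) :
    BilayerWallAt ((Crest / sF + 8 * M * Real.pi / sF + 2 * c₀ * Real.pi * ρ₀ + 3456 + 1152 * (R₀ + 1)) / 2) R₀ σ₁ σ₂ L₁ L₂ s₁ s₂ c := by
  classical
  have hc₀ : 0 ≤ c₀ := (hc0 0 0).trans (hcB 0 0)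
  have hπ := Real.pi_pos.le
  have hM0 : 0 ≤ M := le_trans (by positivity) hM
  refine bilayerWallAt_of_payerBound hσ₁ hσ₂ L₁ L₂ s₁ s₂ R₀ (Crest / sF + 8 * M * Real.pi / sF + 2 * c₀ * Real.pi * ρ₀) hR₀ c ?_
  intro h hh ρ hρ X P₁ P₂ hX hP₁X hP₂X hcell hP₁ hP₂
  have hρ0 : 0 ≤ ρ := by linarith
  have hQ := two_charge_slice_le_cap_area L₁ L₂ s₁ s₂ c hc0 hcB ρ hρ0
  have hPAY := payerSum_nonneg X hX R₀ h
  set PAY := ∑ y ∈ X.filter (fun y => (X.filter fun q => dist y q = 1).card ≠ 12 ∧ -R₀ - 2 ≤ y 2 ∧ y 2 ≤ h + R₀ + 2),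
    ((12 : ℝ) - ((X.filter fun q => dist y q = 1).card : ℝ)) with hPAYdef
  have hK1 : 0 ≤ (Crest / sF + 8 * M * Real.pi / sF) * (1 + h) * ρ := by positivity
  have hK2 : 0 ≤ 2 * c₀ * Real.pi * ρ₀ * (1 + h) * ρ := by
    have : 0 ≤ ρ₀ := by linarith
    positivity
  by_cases hbig : ρ₀ ≤ ρ
  · have hcen := hcensus h hh ρ hbig X P₁ P₂ hX hP₁X hP₂X hcell hP₁ hP₂
    have key := payerBound_of_areaCensus hc₀ hsF hM hρ0 hh hcen
    nlinarith [key, hQ, hK2]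
  · -- small cell: the charge is at most `2 c₀ π ρ₀ · ρ`
    push Not at hbig
    have hsmall : 2 * c₀ * (Real.pi * ρ ^ 2) ≤ 2 * c₀ * Real.pi * ρ₀ * (1 + h) * ρ := by
      have h1 : ρ ^ 2 ≤ ρ₀ * ρ := by nlinarith
      have h2 : ρ₀ * ρ ≤ ρ₀ * (1 + h) * ρ := by
        have : 0 ≤ ρ₀ * ρ := by nlinarith
        nlinarith
      have h3 : 0 ≤ 2 * c₀ * Real.pi := by positivity
      nlinarith [mul_le_mul_of_nonneg_left (h1.trans h2) h3]
    nlinarith [hsmall, hQ, hPAY, hK1]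

end Summit.Ventures.Crystal3D.Theorems

end
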